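import Summits.QuantumFields.YangMills.Theorems.FlatTubeReductionDecimationSupport
import Literature.Probability.Independence.HoeffdingDecompositionTransport
import Literature.MathematicalPhysics.QuantumFieldTheory.StrongCouplingActivities
import HarnessLib

/-!
# Route `FlatTubeReduction`, crux `PinnedUnitStepEx` (stmt-QuantumFields-27561), stub `stub_smearVarPosGS1` — D1b: exactness of the pulled-back parts

Seat ym-line-fcl-p3 g9 (2026-08-28).  Blueprint `WINJ-lean-blueprint-fcl-p3-g9.md`, file D1 (second half) = memo §P2: the path links of distinct
coarse links are DISJOINT (`pathLinks_disjoint`, `L' ≤ L ≤ 2L'`), so updating ONE fine link `f` of the path of `e'` updates only the coarse link `e'`,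
by a two-sided translate `a·y·b` of the new value (`thin_shift_update`); since the Haar probability measure of the compact structure group is left AND
right invariant (`haarProbability.instIsMulRightInvariant`), integrating `f` out of the pull-back of a function is integrating `e'` out of the function
(`condAvg_singleton_comp_thin_shift`), and therefore the pull-back `g^{=R} ∘ thin L' ∘ τ_v` of a Hoeffding part is EXACT on its fine support
`fineSupp L v R` (`condAvg_esPart_comp_thin_shift_eq_zero`).  R2b1 RECORD rung; nothing here is a summit, a crux or the stub.
-/

set_option autoImplicit false

noncomputable section

namespace Summit.QuantumFields.YangMills.Theorems.FlatTubeReduction.Decimation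

open MeasureTheory Finset Function
open Literature.MathematicalPhysics.QuantumFieldTheory (Site Edge GaugeConfig haarProbability)
open Literature.MathematicalPhysics.QuantumFieldTheory.TorusTranslation
open Summit.QuantumFields.YangMills.Theorems.FemtoCutoffLadder.Thinning
open Literature.Probability.Independence.Hoeffding

variable {G : Type*} [Group G] [MeasurableSpace G] {L L' : ℕ} [NeZero L']

/-! ## Disjointness of the path links -/

/-- **Path links of distinct coarse links are disjoint** (`L' ≤ L ≤ 2L'`): a fine link determines the coarse link whose thinning path it lies on.
[folklore] -/
theorem pathLinks_disjoint (hLL : L' ≤ L) {v : Site 3 L} {e₁ e₂ : Edge 3 L'} {f : Edge 3 L}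
    (h₁ : f ∈ pathLinks L v e₁) (h₂ : f ∈ pathLinks L v e₂) : e₁ = e₂ := by
  obtain ⟨s₁, hs₁, rfl⟩ := mem_pathLinks.1 h₁
  obtain ⟨s₂, hs₂, hf⟩ := mem_pathLinks.1 h₂
  obtain ⟨x₁, i₁⟩ := e₁
  obtain ⟨x₂, i₂⟩ := e₂
  simp only [Prod.mk.injEq] at hf
  obtain ⟨hsite, hi⟩ := hf
  subst hi
  have hsite' : thinSite L x₁ + Pi.single i₁ ((s₁ : ℕ) : ZMod L) = thinSite L x₂ + Pi.single i₁ ((s₂ : ℕ) : ZMod L) :=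
    sub_left_injective hsite
  -- coordinates off the direction agree
  have hoff : ∀ k, k ≠ i₁ → x₁ k = x₂ k := by
    intro k hk
    have h := congrFun hsite' k
    simp only [Pi.add_apply, Pi.single_apply, if_neg hk, add_zero, thinSite] at h
    exact thinCoord_injective hLL h
  -- the coordinate in the direction: case analysis on `s₁, s₂ ∈ {0, 1}`
  have hon : x₁ i₁ = x₂ i₁ := by
    have h := congrFun hsite' i₁
    simp only [Pi.add_apply, Pi.single_eq_same, thinSite] at h
    have hs₁' : s₁ < 2 := lt_of_lt_of_le hs₁ (by unfold thinSteps; split_ifs <;> omega)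
    have hs₂' : s₂ < 2 := lt_of_lt_of_le hs₂ (by unfold thinSteps; split_ifs <;> omega)
    have hd₁ : s₁ = 1 → (x₁ i₁).val < L - L' := fun hs => by
      by_contra hc; simp [thinSteps, hc, hs] at hs₁
    have hd₂ : s₂ = 1 → (x₂ i₁).val < L - L' := fun hs => by
      by_contra hc; simp [thinSteps, hc, hs] at hs₂
    interval_cases s₁ <;> interval_cases s₂
    · simp only [Nat.cast_zero, add_zero] at h
      exact thinCoord_injective hLL h
    · simp only [Nat.cast_zero, add_zero, Nat.cast_one] at h
      exact absurd h (thinCoord_add_one_not_mem_range hLL (hd₂ rfl) (x₁ i₁))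
    · simp only [Nat.cast_zero, add_zero, Nat.cast_one] at h
      exact absurd h.symm (thinCoord_add_one_not_mem_range hLL (hd₁ rfl) (x₂ i₁))
    · simp only [Nat.cast_one] at h
      exact thinCoord_injective hLL (add_right_cancel h)
  have hx : x₁ = x₂ := funext fun k => by
    by_cases hk : k = i₁
    · subst hk; exact hon
    · exact hoff k hk
  rw [hx]

/-! ## Updating one fine link -/

/-- Off its own coarse link, updating a fine path link is invisible. [folklore] -/
theorem thin_shift_update_of_ne (hLL : L' ≤ L) {v : Site 3 L} {e' e'' : Edge 3 L'} {f : Edge 3 L} (hf : f ∈ pathLinks L v e')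
    (hne : e'' ≠ e') (U : GaugeConfig 3 L G) (y : G) :
    thin L' (torusConfigShift v (Function.update U f y)) e'' = thin L' (torusConfigShift v U) e'' := by
  refine thin_shift_congr fun f' hf' => ?_
  have hff : f' ≠ f := fun h => hne (pathLinks_disjoint hLL (h ▸ hf') hf)
  rw [Function.update_of_ne hff]

/-- **Updating one fine link of the path of `e'` updates the coarse link `e'` by a two-sided translate of the new value**:
`thin L' (τ_v (U[f ↦ y])) = (thin L' (τ_v U))[e' ↦ a·y·b]` with `a, b` independent of `y`. [folklore] -/
theorem thin_shift_update (hLL : L' ≤ L) {v : Site 3 L} {e' : Edge 3 L'} {f : Edge 3 L} (hf : f ∈ pathLinks L v e')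
    (U : GaugeConfig 3 L G) : ∃ a b : G, ∀ y : G,
      thin L' (torusConfigShift v (Function.update U f y)) = Function.update (thin L' (torusConfigShift v U)) e' (a * y * b) := by
  obtain ⟨x', i⟩ := e'
  obtain ⟨s, hs, rfl⟩ := mem_pathLinks.1 hf
  -- the value at `e'` as a function of `y`
  by_cases hd : (x' i).val < L - L'
  · have hs2 : s < 2 := by simpa [thinSteps, hd] using hs
    have hL : 1 < L := by have := NeZero.one_le (n := L'); omega
    haveI : Fact (1 < L) := ⟨hL⟩
    -- the two path links are distinct
    have hne : (thinSite L x' - v, i) ≠ (thinSite L x' + Pi.single i 1 - v, i) := by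
      intro h
      have h1 := congrFun (sub_left_injective (Prod.mk.inj h).1) i
      simp only [Pi.add_apply, Pi.single_eq_same] at h1
      exact one_ne_zero (left_eq_add.1 h1)
    interval_cases s
    · -- `f` is the first link: value `y * U(second)`
      refine ⟨1, U (thinSite L x' + Pi.single i 1 - v, i), fun y => ?_⟩
      simp only [Nat.cast_zero, Pi.single_zero, add_zero]
      funext e''
      by_cases he : e'' = (x', i)
      · subst he
        rw [Function.update_self, thin_shift_apply, if_pos hd, Function.update_self, Function.update_of_ne hne.symm, one_mul]
      · rw [Function.update_of_ne he]
        exact thin_shift_update_of_ne hLL (by simpa using hf) he U y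
    · -- `f` is the second link: value `U(first) * y`
      refine ⟨U (thinSite L x' - v, i), 1, fun y => ?_⟩
      simp only [Nat.cast_one]
      funext e''
      by_cases he : e'' = (x', i)
      · subst he
        rw [Function.update_self, thin_shift_apply, if_pos hd, Function.update_self, Function.update_of_ne hne, mul_one]
      · rw [Function.update_of_ne he]
        exact thin_shift_update_of_ne hLL (by simpa using hf) he U y
  · have hs1 : s < 1 := by simpa [thinSteps, hd] using hs
    interval_cases s
    refine ⟨1, 1, fun y => ?_⟩
    simp only [Nat.cast_zero, Pi.single_zero, add_zero]
    funext e''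
    by_cases he : e'' = (x', i)
    · subst he
      rw [Function.update_self, thin_shift_apply, if_neg hd, Function.update_self, one_mul, mul_one]
    · rw [Function.update_of_ne he]
      exact thin_shift_update_of_ne hLL (by simpa using hf) he U y

/-! ## Exactness of the pulled-back parts -/

variable [TopologicalSpace G] [IsTopologicalGroup G] [CompactSpace G] [BorelSpace G]

/-- **Integrating out a fine path link = integrating out its coarse link**: for `f ∈ pathLinks L v e'` and any bounded measurable coarse `h`,
`E_{f} (h ∘ thin L' ∘ τ_v) = (E_{e'} h) ∘ thin L' ∘ τ_v` (two-sided invariance of the Haar probability measure). [folklore] -/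
theorem condAvg_singleton_comp_thin_shift (hLL : L' ≤ L) {v : Site 3 L} {e' : Edge 3 L'} {f : Edge 3 L} (hf : f ∈ pathLinks L v e')
    (h : GaugeConfig 3 L' G → ℝ) (U : GaugeConfig 3 L G) :
    condAvg (haarProbability G) {f} (fun W : GaugeConfig 3 L G => h (thin L' (torusConfigShift v W))) U =
      condAvg (haarProbability G) {e'} h (thin L' (torusConfigShift v U)) := by
  rw [condAvg_singleton, condAvg_singleton]
  obtain ⟨a, b, hab⟩ := thin_shift_update hLL hf U
  simp only [hab]
  have h1 := integral_mul_left_eq_self (μ := haarProbability G)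
    (fun z : G => h (Function.update (thin L' (torusConfigShift v U)) e' (z * b))) a
  have h2 := integral_mul_right_eq_self (μ := haarProbability G)
    (fun z : G => h (Function.update (thin L' (torusConfigShift v U)) e' z)) b
  simp only [mul_assoc] at h1 ⊢
  rw [h1]
  exact h2

/-- ★ **The pull-back of a Hoeffding part is exact on its fine support**: for bounded measurable `g`, every `R` and every `f ∈ fineSupp L v R`,
`E_{f} (g^{=R} ∘ thin L' ∘ τ_v) = 0` (memo §P2). [folklore] -/
theorem condAvg_esPart_comp_thin_shift_eq_zero (hLL : L' ≤ L) {g : GaugeConfig 3 L' G → ℝ} (hg : Measurable g) {C : ℝ}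
    (hC : ∀ U', |g U'| ≤ C) (R : Finset (Edge 3 L')) (v : Site 3 L) {f : Edge 3 L} (hf : f ∈ fineSupp L v R) :
    condAvg (haarProbability G) {f}
        (fun W : GaugeConfig 3 L G => esPart (haarProbability G) R g (thin L' (torusConfigShift v W))) = fun _ => 0 := by
  obtain ⟨e', he', hfe⟩ := mem_fineSupp.1 hf
  funext U
  rw [condAvg_singleton_comp_thin_shift hLL hfe]
  rw [condAvg_esPart_eq_zero (μ := haarProbability G) (Finset.mem_singleton_self e') he' hg hC]

end Summit.QuantumFields.YangMills.Theorems.FlatTubeReduction.Decimation
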